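import Summits.ValiantsHypothesis.ValiantsHypothesis.Theorems.DualUnipotentThreeHalves.Negative.InflatedReturnsGeneral

/-!
# `U_{p,k}` generates ALL of `M_{pk}(ℂ)` as an algebra — the HEAVY-TOP ingredient of the ratio knapsack `E(n) = U_{p,k} ⊕ B_{⌊√n⌋}(𝔫_d)`
# (Negative lane of crux `DualUnipotentThreeHalves`, supports stmt-ValiantsHypothesis-24318)

val-port-2 g3 (24318; line α DEAD on paper R304, R2-as-typed BROKEN on paper R310; this is the kernel form of annex §1's heavy-top step, cf. the lead's
re-derivation val-width 21:59:43Z and val-idea-28 g5's MEMO-g5 §1): over ✓ p673673 `Negative/InflatedReturnsGeneral` (`Jp`, `Rp`, `inflSpace`), for `p ≥ 3`: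

  `NonUnitalAlgebra.adjoin ℂ (U_{p,k}) = ⊤`  (`nonUnitalAdjoin_inflSpace_eq_top`; unital corollary `adjoin_inflSpace_eq_top`)

ROUTE (0-indexed): `J^t ⊗ B ∈ 𝒜` for `t ≥ 1` (products of `J ⊗ B` and `J ⊗ 1`); `J^{p−1} = E_{0,p−1}`; `R·E_{0,p−1} = E_{p−2,p−1}` is not needed — instead
`E_{0,p−1}·R = −E_{0,1}`, `E_{0,1}·J^t = E_{0,1+t}`, `E_{0,p−2}·R = E_{0,0}` give the whole ROW `E_{0,t} ⊗ B`; then `R·E_{0,t} = E_{p−2,t}`, `J^u·E_{p−2,t} = E_{p−2−u,t}`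
give rows `0 … p−2`, and `R·E_{1,t} = −E_{p−1,t}` the last row; finally every `X ∈ M_{pk}` is `Σ_{s,t} E_{st} ⊗ X_{[s,t]}`.
CONSEQUENCE (used by the E(n) files): the pencil algebra of any pencil whose values fill `U_{p,k} ⊕ 0` contains `M_{pk} ⊕ 0`, so a trace-orthogonal
direction space has NO `U`-component (`RadOrth K ⟹ K ⊆ 0 ⊕ ℂ^Z`): E(n) is heavy-top.  Honest framing: plain linear algebra about one explicit family;
nothing here is a `¬`-theorem, nothing touches 24318 / 8062, `VP ≠ VNP` is NOT proved.  One private-use definition (`Eb`, the matrix units, the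
witness's own data); no named facts. [MOR 1991 §5; val-idea-30 g3; crit-7 g2 V19 annex §1]
-/

set_option linter.dupNamespace false
set_option autoImplicit false

open Matrix
open scoped Kronecker BigOperators

namespace Summit.ValiantsHypothesis.ValiantsHypothesis.Theorems.DualUnipotentThreeHalvesNegative.InflatedReturnsGeneral

variable (p k : ℕ)

/-! ## §1 Matrix units and the identities of the letters -/

/-- The matrix unit `E_{ab}`. -/
def Eb (a b : Fin p) : Matrix (Fin p) (Fin p) ℂ := fun i j => if i = a ∧ j = b then 1 else 0

/-- `E_{ab} · E_{bc} = E_{ac}`. -/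
lemma Eb_mul_Eb_same (a b c : Fin p) : Eb p a b * Eb p b c = Eb p a c := by
  ext i j
  rw [Matrix.mul_apply, Finset.sum_eq_single b]
  · by_cases hi : i = a <;> by_cases hj : j = c <;> simp [Eb, hi, hj]
  · intro l _ hl; simp [Eb, hl]
  · intro h; exact absurd (Finset.mem_univ b) h

/-- `E_{ab} · E_{b'c} = 0` for `b ≠ b'`. -/
lemma Eb_mul_Eb_ne (a b b' c : Fin p) (hb : b ≠ b') : Eb p a b * Eb p b' c = 0 := by
  ext i j
  rw [Matrix.mul_apply, Matrix.zero_apply]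
  refine Finset.sum_eq_zero fun l _ => ?_
  by_cases hl : l = b
  · subst hl; simp [Eb, hb]
  · simp [Eb, hl]

/-- `(-A) ⊗ B = -(A ⊗ B)`. -/
lemma neg_kronecker' {k : ℕ} (A : Matrix (Fin p) (Fin p) ℂ) (B : Matrix (Fin k) (Fin k) ℂ) : (-A) ⊗ₖ B = -(A ⊗ₖ B) := by
  ext ⟨i, a⟩ ⟨j, b⟩
  simp [Matrix.kroneckerMap_apply]

/-- Powers of `J_p`: `(J_p^t) i j = [j = i + t]`. -/
lemma Jp_pow_apply : ∀ (t : ℕ) (i j : Fin p), (Jp p ^ t) i j = if (j : ℕ) = i + t then 1 else 0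
  | 0, i, j => by
      rw [pow_zero, Matrix.one_apply]
      by_cases h : i = j
      · subst h; simp
      · rw [if_neg h, if_neg]
        intro e
        exact h (Fin.ext (by omega))
  | t + 1, i, j => by
      rw [pow_succ, Matrix.mul_apply]
      by_cases hj : (j : ℕ) = i + (t + 1)
      · rw [if_pos hj]
        have hlt : (i : ℕ) + t < p := by omega
        rw [Finset.sum_eq_single ⟨i + t, hlt⟩]
        · rw [Jp_pow_apply t]; simp [Jp]; omega
        · intro l _ hl
          rw [Jp_pow_apply t]
          have : ¬ ((l : ℕ) = i + t) := fun e => hl (Fin.ext (by simpa using e))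
          simp [this]
        · intro h; exact absurd (Finset.mem_univ _) h
      · rw [if_neg hj]
        refine Finset.sum_eq_zero fun l _ => ?_
        rw [Jp_pow_apply t]
        by_cases hl : (l : ℕ) = i + t
        · have : ¬ ((j : ℕ) = l + 1) := by omega
          simp [Jp, this]
        · simp [hl]

/-- `J_p^t = Σ`-free form: `J_p^t · E`-calculus — `J_p^{p−1} = E_{0,p−1}` (`p ≥ 1`). -/
lemma Jp_pow_pred (hp : 1 ≤ p) : Jp p ^ (p - 1) = Eb p ⟨0, by omega⟩ ⟨p - 1, by omega⟩ := by
  ext i j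
  rw [Jp_pow_apply]
  simp only [Eb, Fin.ext_iff]
  by_cases h : (j : ℕ) = i + (p - 1)
  · have hi : (i : ℕ) = 0 := by omega
    simp [h, hi]
  · have : ¬ ((i : ℕ) = 0 ∧ (j : ℕ) = p - 1) := by omega
    simp [h, this]

/-- `E_{a,b} · J_p^t = E_{a,b+t}` (target column explicit). -/
lemma Eb_mul_Jp_pow (a b c : Fin p) (t : ℕ) (hc : (c : ℕ) = b + t) : Eb p a b * Jp p ^ t = Eb p a c := by
  ext i j
  simp only [Matrix.mul_apply, Eb]
  rw [Finset.sum_eq_single b]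
  · rw [Jp_pow_apply]
    by_cases hi : i = a <;> by_cases hj : j = c
    · subst hj; simp [hi, hc]
    · have : ¬ ((j : ℕ) = b + t) := fun e => hj (Fin.ext (by omega)); simp [hi, hj, this]
    · simp [hi]
    · simp [hi]
  · intro l _ hl; simp [hl]
  · intro h; exact absurd (Finset.mem_univ b) h

/-- `J_p^t · E_{a,b} = E_{c,b}` with `c + t = a` (target row explicit). -/
lemma Jp_pow_mul_Eb (a b c : Fin p) (t : ℕ) (hc : (c : ℕ) + t = a) : Jp p ^ t * Eb p a b = Eb p c b := by
  ext i j
  simp only [Matrix.mul_apply, Eb]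
  rw [Finset.sum_eq_single a]
  · rw [Jp_pow_apply]
    by_cases hi : i = c <;> by_cases hj : j = b
    · subst hi; simp [hj, hc.symm]
    · simp [hj]
    · have : ¬ ((a : ℕ) = i + t) := fun e => hi (Fin.ext (by omega)); simp [this, hi]
    · simp [hj]
  · intro l _ hl; simp [hl]
  · intro h; exact absurd (Finset.mem_univ a) h

/-- `R_p = E_{p−2,0} − E_{p−1,1}` (`p ≥ 2`). -/
lemma Rp_eq (hp : 2 ≤ p) : Rp p = Eb p ⟨p - 2, by omega⟩ ⟨0, by omega⟩ - Eb p ⟨p - 1, by omega⟩ ⟨1, by omega⟩ := by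
  ext i j
  simp only [Rp, Eb, Matrix.sub_apply, Fin.ext_iff]
  by_cases hA : (i : ℕ) + 2 = p ∧ (j : ℕ) = 0
  · have hB : ¬ ((i : ℕ) + 1 = p ∧ (j : ℕ) = 1) := by omega
    have hC : ((i : ℕ) = p - 2 ∧ (j : ℕ) = 0) := by omega
    have hD : ¬ ((i : ℕ) = p - 1 ∧ (j : ℕ) = 1) := by omega
    rw [if_pos hA, if_pos hC, if_neg hD]; norm_num
  · by_cases hB : (i : ℕ) + 1 = p ∧ (j : ℕ) = 1
    · have hC : ¬ ((i : ℕ) = p - 2 ∧ (j : ℕ) = 0) := by omega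
      have hD : ((i : ℕ) = p - 1 ∧ (j : ℕ) = 1) := by omega
      rw [if_neg hA, if_pos hB, if_neg hC, if_pos hD]; norm_num
    · have hC : ¬ ((i : ℕ) = p - 2 ∧ (j : ℕ) = 0) := by omega
      have hD : ¬ ((i : ℕ) = p - 1 ∧ (j : ℕ) = 1) := by omega
      rw [if_neg hA, if_neg hB, if_neg hC, if_neg hD]; norm_num

/-! ## §2 The generated algebra is everything -/

variable {p k}

/-- Every `E_{st} ⊗ B` lies in the NON-UNITAL algebra generated by `U_{p,k}` (`p ≥ 3`) — i.e. is a combination of products of POSITIVE length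
in elements of `U_{p,k}` (no `1`, no scalars: this is the form the heavy-top transfer to `E(n) = U ⊕ band` needs, crit-7 g3 22:36:35Z (3)). -/
theorem Eb_kronecker_mem_adjoin (hp : 3 ≤ p) (s t : Fin p) (B : Matrix (Fin k) (Fin k) ℂ) :
    Eb p s t ⊗ₖ B ∈ NonUnitalAlgebra.adjoin ℂ (inflSpace p k : Set (Matrix (ι p k) (ι p k) ℂ)) := by
  set 𝒜 := NonUnitalAlgebra.adjoin ℂ (inflSpace p k : Set (Matrix (ι p k) (ι p k) ℂ)) with h𝒜
  have hJB : ∀ B : Matrix (Fin k) (Fin k) ℂ, Jp p ⊗ₖ B ∈ 𝒜 := fun B => NonUnitalAlgebra.subset_adjoin ℂ (JA_mem p k B)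
  have hR : Rp p ⊗ₖ (1 : Matrix (Fin k) (Fin k) ℂ) ∈ 𝒜 := NonUnitalAlgebra.subset_adjoin ℂ (R1_mem p k)
  have hneg : ∀ x, x ∈ 𝒜 → -x ∈ 𝒜 := fun x hx => by simpa using 𝒜.smul_mem (-1 : ℂ) hx
  -- powers of `J ⊗ 1` act on `𝒜` from both sides (for the power `0` trivially)
  have hJ1pow_eq : ∀ t : ℕ, (Jp p ⊗ₖ (1 : Matrix (Fin k) (Fin k) ℂ)) ^ t = (Jp p ^ t) ⊗ₖ (1 : Matrix (Fin k) (Fin k) ℂ) := by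
    intro t
    induction t with
    | zero => rw [pow_zero, pow_zero, Matrix.one_kronecker_one]
    | succ t ih => rw [pow_succ, ih, ← Matrix.mul_kronecker_mul, Matrix.one_mul, ← pow_succ]
  have hmulJ : ∀ (t : ℕ) (x : Matrix (ι p k) (ι p k) ℂ), x ∈ 𝒜 → x * (Jp p ⊗ₖ (1 : Matrix (Fin k) (Fin k) ℂ)) ^ t ∈ 𝒜 := by
    intro t
    induction t with
    | zero => intro x hx; simpa using hx
    | succ t ih => intro x hx; rw [pow_succ, ← mul_assoc]; exact 𝒜.mul_mem (ih x hx) (hJB 1)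
  have hJmul : ∀ (t : ℕ) (x : Matrix (ι p k) (ι p k) ℂ), x ∈ 𝒜 → (Jp p ⊗ₖ (1 : Matrix (Fin k) (Fin k) ℂ)) ^ t * x ∈ 𝒜 := by
    intro t
    induction t with
    | zero => intro x hx; simpa using hx
    | succ t ih => intro x hx; rw [pow_succ, mul_assoc]; exact ih _ (𝒜.mul_mem (hJB 1) hx)
  -- `J^{p−1} ⊗ B = E_{0,p−1} ⊗ B ∈ 𝒜`
  set z : Fin p := ⟨0, by omega⟩ with hz
  set l₁ : Fin p := ⟨p - 1, by omega⟩ with hl₁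
  have h0l : ∀ B : Matrix (Fin k) (Fin k) ℂ, Eb p z l₁ ⊗ₖ B ∈ 𝒜 := by
    intro B
    have : (Jp p ⊗ₖ B) * (Jp p ⊗ₖ (1 : Matrix (Fin k) (Fin k) ℂ)) ^ (p - 2) = Eb p z l₁ ⊗ₖ B := by
      rw [hJ1pow_eq, ← Matrix.mul_kronecker_mul, Matrix.mul_one, ← pow_succ', show p - 2 + 1 = p - 1 by omega,
        Jp_pow_pred p (by omega)]
    rw [← this]
    exact hmulJ _ _ (hJB B)
  -- `E_{0,1} ⊗ B ∈ 𝒜`: `(E_{0,p−1} ⊗ B)(R ⊗ 1) = (E_{0,p−1} R) ⊗ B = −E_{0,1} ⊗ B`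
  set o : Fin p := ⟨1, by omega⟩ with ho
  have h01 : ∀ B : Matrix (Fin k) (Fin k) ℂ, Eb p z o ⊗ₖ B ∈ 𝒜 := by
    intro B
    have hprod : (Eb p z l₁ ⊗ₖ B) * (Rp p ⊗ₖ (1 : Matrix (Fin k) (Fin k) ℂ)) = -(Eb p z o ⊗ₖ B) := by
      rw [← Matrix.mul_kronecker_mul, Matrix.mul_one, Rp_eq p (by omega), Matrix.mul_sub,
        Eb_mul_Eb_ne p _ _ _ _ (fun e => by simp [hl₁, Fin.ext_iff] at e; omega),
        show (⟨p - 1, by omega⟩ : Fin p) = l₁ from rfl, Eb_mul_Eb_same, zero_sub, neg_kronecker']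
    have := 𝒜.mul_mem (h0l B) hR
    rw [hprod] at this
    simpa using hneg _ this
  -- the whole first row: `E_{0,t} ⊗ B ∈ 𝒜`
  have hrow0 : ∀ (t : Fin p) (B : Matrix (Fin k) (Fin k) ℂ), Eb p z t ⊗ₖ B ∈ 𝒜 := by
    intro t B
    rcases Nat.eq_zero_or_pos (t : ℕ) with ht | ht
    · -- `E_{0,0} ⊗ B = (E_{0,p−2} ⊗ B)(R ⊗ 1)`, and `E_{0,p−2} = E_{0,1} J^{p−3}`
      have hl₂ : Eb p z o * Jp p ^ (p - 3) = Eb p z ⟨p - 2, by omega⟩ := Eb_mul_Jp_pow p z o _ (p - 3) (by simp [ho]; omega)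
      have hm : Eb p z ⟨p - 2, by omega⟩ ⊗ₖ B ∈ 𝒜 := by
        have := hmulJ (p - 3) _ (h01 B)
        rwa [hJ1pow_eq, ← Matrix.mul_kronecker_mul, Matrix.mul_one, hl₂] at this
      have hprod : (Eb p z ⟨p - 2, by omega⟩ ⊗ₖ B) * (Rp p ⊗ₖ (1 : Matrix (Fin k) (Fin k) ℂ)) = Eb p z t ⊗ₖ B := by
        have htz : t = z := Fin.ext (by simp [hz]; omega)
        rw [← Matrix.mul_kronecker_mul, Matrix.mul_one, Rp_eq p (by omega), Matrix.mul_sub, Eb_mul_Eb_same,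
          Eb_mul_Eb_ne p _ _ _ _ (fun e => by simp [Fin.ext_iff] at e; omega), sub_zero, htz]
      have := 𝒜.mul_mem hm hR
      rwa [hprod] at this
    · have he : Eb p z o * Jp p ^ ((t : ℕ) - 1) = Eb p z t := Eb_mul_Jp_pow p z o t _ (by simp [ho]; omega)
      have := hmulJ ((t : ℕ) - 1) _ (h01 B)
      rwa [hJ1pow_eq, ← Matrix.mul_kronecker_mul, Matrix.mul_one, he] at this
  -- row `p−2`: `(R ⊗ 1)(E_{0,t} ⊗ B) = E_{p−2,t} ⊗ B`; rows `≤ p−2` by `J^u`; row `p−1` by `(R ⊗ 1)(E_{1,t} ⊗ B) = −E_{p−1,t} ⊗ B`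
  have hrowp2 : ∀ (t : Fin p) (B : Matrix (Fin k) (Fin k) ℂ), Eb p ⟨p - 2, by omega⟩ t ⊗ₖ B ∈ 𝒜 := by
    intro t B
    have hprod : (Rp p ⊗ₖ (1 : Matrix (Fin k) (Fin k) ℂ)) * (Eb p z t ⊗ₖ B) = Eb p ⟨p - 2, by omega⟩ t ⊗ₖ B := by
      rw [← Matrix.mul_kronecker_mul, Matrix.one_mul, Rp_eq p (by omega), Matrix.sub_mul,
        show (⟨0, by omega⟩ : Fin p) = z from rfl, Eb_mul_Eb_same,
        Eb_mul_Eb_ne p _ _ _ _ (fun e => by simp [hz, Fin.ext_iff] at e), sub_zero]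
    have := 𝒜.mul_mem hR (hrow0 t B)
    rwa [hprod] at this
  have hle : ∀ (s t : Fin p), (s : ℕ) ≤ p - 2 → ∀ B : Matrix (Fin k) (Fin k) ℂ, Eb p s t ⊗ₖ B ∈ 𝒜 := by
    intro s t hs B
    have he : Jp p ^ (p - 2 - (s : ℕ)) * Eb p ⟨p - 2, by omega⟩ t = Eb p s t := Jp_pow_mul_Eb p _ t s _ (by simp; omega)
    have := hJmul (p - 2 - (s : ℕ)) _ (hrowp2 t B)
    rwa [hJ1pow_eq, ← Matrix.mul_kronecker_mul, Matrix.one_mul, he] at this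
  by_cases hs : (s : ℕ) ≤ p - 2
  · exact hle s t hs B
  · have hsv : s = ⟨p - 1, by omega⟩ := Fin.ext (by simp; omega)
    have hprod : (Rp p ⊗ₖ (1 : Matrix (Fin k) (Fin k) ℂ)) * (Eb p o t ⊗ₖ B) = -(Eb p s t ⊗ₖ B) := by
      rw [← Matrix.mul_kronecker_mul, Matrix.one_mul, Rp_eq p (by omega), Matrix.sub_mul,
        Eb_mul_Eb_ne p _ _ _ _ (fun e => by simp [ho, Fin.ext_iff] at e),
        show (⟨1, by omega⟩ : Fin p) = o from rfl, Eb_mul_Eb_same, zero_sub, hsv, neg_kronecker']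
    have := 𝒜.mul_mem hR (hle o t (by simp [ho]; omega) B)
    rw [hprod] at this
    simpa using hneg _ this

/-- Every matrix on `Fin p × Fin k` is the sum of its blocks: `X = Σ_{s,t} E_{st} ⊗ X_{[s,t]}`. -/
lemma eq_sum_Eb_kronecker (X : Matrix (ι p k) (ι p k) ℂ) :
    X = ∑ s : Fin p, ∑ t : Fin p, Eb p s t ⊗ₖ (Matrix.of fun a b => X (s, a) (t, b)) := by
  ext ⟨i, a⟩ ⟨j, b⟩
  simp only [Matrix.sum_apply, Matrix.kroneckerMap_apply, Eb, Matrix.of_apply, ite_mul, one_mul, zero_mul]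
  rw [Finset.sum_eq_single i]
  · rw [Finset.sum_eq_single j]
    · simp
    · intro t _ ht; simp [Ne.symm ht]
    · intro h; exact absurd (Finset.mem_univ j) h
  · intro s _ hs; exact Finset.sum_eq_zero fun t _ => by simp [Ne.symm hs]
  · intro h; exact absurd (Finset.mem_univ i) h

/-- ★ **`U_{p,k}` generates `M_{pk}(ℂ)` WITHOUT UNIT** (`p ≥ 3`): the non-unital algebra (combinations of positive-length products) generated by
`U_{p,k}` is everything.  This is the form the heavy-top transfer to `E(n) = U_{p,k} ⊕ band` consumes (values of `E(n)` are block-diagonal; long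
products kill the band part; positive-length `U`-words already give all of `M_{pk}`). [MOR 1991 §5; val-idea-30 g3; crit-7 g2 V19 annex §1] -/
theorem nonUnitalAdjoin_inflSpace_eq_top (hp : 3 ≤ p) :
    NonUnitalAlgebra.adjoin ℂ (inflSpace p k : Set (Matrix (ι p k) (ι p k) ℂ)) = ⊤ := by
  rw [eq_top_iff]
  intro X _
  rw [eq_sum_Eb_kronecker X]
  exact sum_mem fun s _ => sum_mem fun t _ => Eb_kronecker_mem_adjoin hp s t _

/-- **`U_{p,k}` generates `M_{pk}(ℂ)`** (unital form): `Algebra.adjoin ℂ U_{p,k} = ⊤`. -/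
theorem adjoin_inflSpace_eq_top (hp : 3 ≤ p) :
    Algebra.adjoin ℂ (inflSpace p k : Set (Matrix (ι p k) (ι p k) ℂ)) = ⊤ := by
  rw [eq_top_iff]
  intro X _
  have hX : X ∈ NonUnitalAlgebra.adjoin ℂ (inflSpace p k : Set (Matrix (ι p k) (ι p k) ℂ)) := by
    rw [nonUnitalAdjoin_inflSpace_eq_top hp]; exact NonUnitalAlgebra.mem_top
  have hle : NonUnitalAlgebra.adjoin ℂ (inflSpace p k : Set (Matrix (ι p k) (ι p k) ℂ)) ≤
      (Algebra.adjoin ℂ (inflSpace p k : Set (Matrix (ι p k) (ι p k) ℂ))).toNonUnitalSubalgebra :=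
    NonUnitalAlgebra.adjoin_le Algebra.subset_adjoin
  exact Subalgebra.mem_toNonUnitalSubalgebra.mp (hle hX)

end Summit.ValiantsHypothesis.ValiantsHypothesis.Theorems.DualUnipotentThreeHalvesNegative.InflatedReturnsGeneral
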